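import Mathlib.RingTheory.AdicCompletion.Basic
import Mathlib.RingTheory.IntegralClosure.IsIntegralClosure.Basic
import Mathlib.RingTheory.IntegralClosure.IntegrallyClosed
import Mathlib.RingTheory.Localization.FractionRing
import Mathlib.RingTheory.Localization.Integer
import Mathlib.RingTheory.Noetherian.Basic
import Mathlib.RingTheory.Ideal.Quotient.Noetherian
import Mathlib.RingTheory.Finiteness.Cardinality
import Mathlib.LinearAlgebra.Dimension.Finite
import Mathlib.LinearAlgebra.FiniteDimensional.Defs
import Mathlib.FieldTheory.Finiteness
import Literature.Algebra.Module.CompleteNakayama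
import HarnessLib

/-!
# Tate's theorem on Japanese rings — the purely inseparable core (EGA 0_IV 23.1.3; Stacks 10.161.16)

Topic: `Literature/AlgebraicGeometry/Resolution`. The Stacks Project, Lemma 10.161.16 (Tate) [EGA,
Chapter 0, Theorem 23.1.3]: *"Let `R` be a ring. Let `x ∈ R`. Assume (1) `R` is a normal Noetherian
domain, (2) `R/xR` is a domain and N-2, (3) `R ≅ lim R/xⁿR` is complete with respect to `x`. Then `R`
is N-2."* The printed proof reduces (Lemmas 10.161.11, 10.161.12) to a finite purely inseparable
extension `L/K` of the fraction field, `L^q ⊆ K`, containing `y` with `y^q = x`, and then argues: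
*"`𝔮 = {f ∈ S | f^q ∈ 𝔭} = yS` … `κ(𝔮)/κ(𝔭)` is a finite field extension. Hence the integral closure
`S' ⊂ κ(𝔮)` of `R/xR` is finite over `R/xR` by assumption (2). Since `S/yS ⊂ S'` this implies that
`S/yS` is finite over `R`. Note that `S/yⁿS` has a finite filtration whose subquotients are the
modules `yⁱS/yⁱ⁺¹S ≅ S/yS`. Hence we see that each `S/yⁿS` is finite over `R`. In particular `S/xS`
is finite over `R`. Also, it is clear that `⋂ xⁿS = (0)` … Thus we may apply Lemma 10.96.12 to
conclude that `S` is finite over `R`."*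

This file PROVES exactly this core (`module_finite_integralClosure_of_pow_mem` below), with one
simplification of the printed route: the finiteness of `κ(𝔮)/κ(𝔭)` is obtained not from
Krull–Akizuki but from the elementary bound `[κ(𝔮) : κ(𝔭)] ≤ [L : K]` — a relation among lifts of
`κ(𝔭)`-independent residues has all its coefficients divisible by `x`, hence by every power of `x`,
hence zero (`R` is `x`-adically separated). "N-2 for `R/xR`" enters as the hypothesis `hN2`, spelled
out (no definition is introduced): the integral closure of `R/xR` in every finite extension of its
field of fractions is module-finite. Lemma 10.96.12 is the tree's
`Literature.Algebra.Module.finite_of_isHausdorff_of_forall_mem_sup` (Matsumura Thm. 8.4).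

No definitions, no named facts. Step 2 of the discharge of
`EGAIV2_7_7_4_finiteNormalization_completeLocal` (`FiniteNormalizationCompleteLocalBase.lean`).

## References

* [StacksProject] The Stacks Project, Tag 0BI1 (Section 10.161), Lemma 10.161.16 (Tate).
* [EGA0IV] A. Grothendieck, J. Dieudonné, EGA IV₁ (Chap. 0), Publ. Math. IHÉS 20 (1964), 0_IV (23.1.3) (Tate).
-/

noncomputable section

open scoped Pointwise nonZeroDivisors

namespace Literature.AlgebraicGeometry.Resolution

universe u

/-! ## A rank bound for an extension of fields of fractions -/

/-- If every `R₀`-linearly independent family in the domain `S₀ ⊇ R₀` has at most `n` members, then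
`Frac S₀` has dimension `≤ n` over `Frac R₀` (clear denominators). Used for
`[κ(𝔮) : κ(𝔭)] ≤ [L : K]` in Tate's proof. [cite: StacksProject, Tag 0BI1 (proof of Lemma 10.161.16)] -/
theorem rank_fractionRing_le_of_linearIndependent_le {R₀ S₀ k₀ E : Type*} [CommRing R₀]
    [CommRing S₀] [IsDomain S₀] [Algebra R₀ S₀] [Field k₀] [Field E] [Algebra R₀ k₀]
    [IsFractionRing R₀ k₀] [Algebra S₀ E] [IsFractionRing S₀ E] [Algebra k₀ E] [Algebra R₀ E]
    [IsScalarTower R₀ k₀ E] [IsScalarTower R₀ S₀ E] (n : ℕ)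
    (H : ∀ (m : ℕ) (w : Fin m → S₀), LinearIndependent R₀ w → m ≤ n) :
    Module.rank k₀ E ≤ n := by
  classical
  refine _root_.rank_le fun t ht => ?_
  -- clear denominators
  obtain ⟨b, hb⟩ := IsLocalization.exist_integer_multiples_of_finite S₀⁰ (fun i : t => (i : E))
  choose w hw using hb
  -- `i ↦ algebraMap S₀ E (w i) = b • i` is still linearly independent over `k₀`
  have hb0 : algebraMap S₀ E (b : S₀) ≠ 0 :=
    IsFractionRing.to_map_ne_zero_of_mem_nonZeroDivisors b.2
  have hli : LinearIndependent k₀ (fun i : t => algebraMap S₀ E (w i)) := by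
    have h1 : LinearIndependent k₀ (LinearMap.mulLeft k₀ (algebraMap S₀ E (b : S₀)) ∘
        fun i : t => (i : E)) := by
      refine ht.map' _ ?_
      exact LinearMap.ker_eq_bot.mpr (mul_right_injective₀ hb0)
    convert h1 using 1
    ext i
    simp only [Function.comp_apply, LinearMap.mulLeft_apply, hw, Algebra.smul_def]
  -- hence `w` is linearly independent over `R₀`
  have hli' : LinearIndependent R₀ (fun i : Fin t.card => w (t.equivFin.symm i)) := by
    rw [Fintype.linearIndependent_iff]
    intro c hc i
    have hrel : ∑ j, algebraMap R₀ k₀ (c j) • algebraMap S₀ E (w (t.equivFin.symm j)) = 0 := by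
      have := congrArg (algebraMap S₀ E) hc
      rw [map_sum, map_zero] at this
      rw [← this]
      refine Finset.sum_congr rfl fun j _ => ?_
      rw [Algebra.smul_def, Algebra.smul_def, map_mul, ← IsScalarTower.algebraMap_apply R₀ k₀ E,
        ← IsScalarTower.algebraMap_apply R₀ S₀ E]
    have hli2 : LinearIndependent k₀
        (fun j : Fin t.card => algebraMap S₀ E (w (t.equivFin.symm j))) :=
      hli.comp _ t.equivFin.symm.injective
    have := (Fintype.linearIndependent_iff.mp hli2) (fun j => algebraMap R₀ k₀ (c j)) hrel i
    exact (IsFractionRing.injective R₀ k₀) (by rw [this, map_zero])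
  simpa using H t.card _ hli'

/-! ## A filtration lemma: `S/yⁿS` is Noetherian over `R` when `S/yS` is -/

/-- If `S/yS` is a Noetherian `R`-module then so is every `S/yⁿS` ("`S/yⁿS` has a finite filtration
whose subquotients are the modules `yⁱS/yⁱ⁺¹S`", quotients of `S/yS`).
[cite: StacksProject, Tag 0BI1 (proof of Lemma 10.161.16)] -/
theorem isNoetherian_quotient_span_singleton_pow {R S : Type*} [CommRing R] [CommRing S]
    [Algebra R S] (y : S)
    (h1 : IsNoetherian R (S ⧸ (Ideal.span {y}).restrictScalars R)) (n : ℕ) :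
    IsNoetherian R (S ⧸ (Ideal.span {y ^ n}).restrictScalars R) := by
  induction n with
  | zero =>
    have htop : (Ideal.span {(y ^ 0 : S)}).restrictScalars R = ⊤ := by
      rw [pow_zero, Ideal.span_singleton_one]; rfl
    rw [htop]
    infer_instance
  | succ n ih =>
    -- `f : S/yS → S/yⁿ⁺¹S`, `t ↦ yⁿ t`, and `g : S/yⁿ⁺¹S → S/yⁿS`
    let J : ℕ → Submodule R S := fun k => (Ideal.span {y ^ k}).restrictScalars R
    have hJ1 : J 1 ≤ (J (n + 1)).comap (LinearMap.mulLeft R (y ^ n)) := by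
      intro t ht
      change y ^ n * t ∈ Ideal.span {y ^ (n + 1)}
      obtain ⟨c, rfl⟩ := Ideal.mem_span_singleton'.mp (by simpa [J] using ht)
      exact Ideal.mem_span_singleton'.mpr ⟨c, by ring⟩
    have hle : J (n + 1) ≤ J n := by
      intro t ht
      obtain ⟨c, rfl⟩ := Ideal.mem_span_singleton'.mp (show t ∈ Ideal.span {y ^ (n + 1)} from ht)
      exact Ideal.mem_span_singleton'.mpr ⟨c * y, by ring⟩
    let f : (S ⧸ J 1) →ₗ[R] (S ⧸ J (n + 1)) := Submodule.mapQ (J 1) (J (n + 1)) _ hJ1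
    let g : (S ⧸ J (n + 1)) →ₗ[R] (S ⧸ J n) := Submodule.factor hle
    have h1' : IsNoetherian R (S ⧸ J 1) := by
      show IsNoetherian R (S ⧸ (Ideal.span {y ^ 1}).restrictScalars R)
      rw [pow_one]; exact h1
    haveI : IsNoetherian R (S ⧸ J n) := ih
    refine isNoetherian_of_range_eq_ker f g (le_antisymm ?_ ?_)
    · rintro _ ⟨z, rfl⟩
      obtain ⟨t, rfl⟩ := Submodule.Quotient.mk_surjective (J 1) z
      rw [LinearMap.mem_ker]
      change g (Submodule.Quotient.mk (y ^ n * t)) = 0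
      simp only [g, Submodule.factor, Submodule.mapQ_apply, LinearMap.id_coe, id_eq,
        Submodule.Quotient.mk_eq_zero]
      exact Ideal.mem_span_singleton'.mpr ⟨t, by ring⟩
    · intro z hz
      obtain ⟨s, rfl⟩ := Submodule.Quotient.mk_surjective (J (n + 1)) z
      have hs : s ∈ J n := by
        simpa [g, Submodule.factor, Submodule.mapQ_apply, Submodule.Quotient.mk_eq_zero] using hz
      obtain ⟨t, rfl⟩ := Ideal.mem_span_singleton'.mp (show s ∈ Ideal.span {y ^ n} from hs)
      exact ⟨Submodule.Quotient.mk t, by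
        simp only [f, Submodule.mapQ_apply, LinearMap.mulLeft_apply, mul_comm]⟩

/-! ## Finiteness of an integral extension of domains from a rank bound and N-2 -/

/-- If `R₀ ⊆ S₀` is an integral extension of domains, `R₀` Noetherian with module-finite integral
closures in finite extensions of `Frac R₀` ("N-2"), and `R₀`-linearly independent families in `S₀`
have bounded size, then `S₀` is a finite `R₀`-module: `Frac S₀` is then a finite extension of
`Frac R₀` and `S₀` embeds in the integral closure of `R₀` in it ("Since `S/yS ⊂ S'` this implies that
`S/yS` is finite"). [cite: StacksProject, Tag 0BI1 (proof of Lemma 10.161.16)] -/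
theorem module_finite_of_isIntegral_of_linearIndependent_le {R₀ S₀ : Type u} [CommRing R₀]
    [IsDomain R₀] [IsNoetherianRing R₀] [CommRing S₀] [IsDomain S₀] [Algebra R₀ S₀]
    [Algebra.IsIntegral R₀ S₀] (hinj : Function.Injective (algebraMap R₀ S₀))
    (hN2 : ∀ (k₀ E : Type u) [Field k₀] [Field E] [Algebra R₀ k₀] [IsFractionRing R₀ k₀]
      [Algebra k₀ E] [Algebra R₀ E] [IsScalarTower R₀ k₀ E] [FiniteDimensional k₀ E],
      Module.Finite R₀ (integralClosure R₀ E))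
    (n : ℕ) (H : ∀ (m : ℕ) (w : Fin m → S₀), LinearIndependent R₀ w → m ≤ n) :
    Module.Finite R₀ S₀ := by
  let k₀ := FractionRing R₀
  let E := FractionRing S₀
  have hinjE : Function.Injective (Algebra.ofId R₀ E) := by
    change Function.Injective (algebraMap R₀ E)
    rw [IsScalarTower.algebraMap_eq R₀ S₀ E, RingHom.coe_comp]
    exact (IsFractionRing.injective S₀ E).comp hinj
  let ψ : k₀ →ₐ[R₀] E := IsFractionRing.liftAlgHom (K := k₀) hinjE
  letI : Algebra k₀ E := ψ.toRingHom.toAlgebra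
  haveI : IsScalarTower R₀ k₀ E :=
    IsScalarTower.of_algebraMap_eq fun r => (ψ.commutes r).symm
  haveI : FiniteDimensional k₀ E := by
    have hrank : Module.rank k₀ E ≤ n :=
      rank_fractionRing_le_of_linearIndependent_le (R₀ := R₀) (S₀ := S₀) n H
    exact Module.rank_lt_aleph0_iff.mp (lt_of_le_of_lt hrank Cardinal.natCast_lt_aleph0)
  haveI : Module.Finite R₀ (integralClosure R₀ E) := hN2 k₀ E
  have hint : ∀ z : S₀, (IsScalarTower.toAlgHom R₀ S₀ E) z ∈ integralClosure R₀ E := fun z =>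
    (Algebra.IsIntegral.isIntegral z).map (IsScalarTower.toAlgHom R₀ S₀ E)
  let emb : S₀ →ₐ[R₀] integralClosure R₀ E := (IsScalarTower.toAlgHom R₀ S₀ E).codRestrict _ hint
  have hemb : Function.Injective emb := fun a b h =>
    IsFractionRing.injective S₀ E (congrArg Subtype.val h :)
  exact Module.Finite.of_injective emb.toLinearMap hemb

/-! ## Linear independence from relations divisible by `x` -/

/-- If `R` is `x`-adically separated, `x ≠ 0`, and every `R`-linear relation among
`v₁, …, v_m ∈ L` has all its coefficients in `xR`, then the `vᵢ` are linearly independent over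
`K = Frac R` (divide the relation by `x` indefinitely). This replaces Krull–Akizuki in the bound
`[κ(𝔮) : κ(𝔭)] ≤ [L : K]` of Tate's proof. [cite: StacksProject, Tag 0BI1 (proof of Lemma 10.161.16)] -/
theorem linearIndependent_of_forall_relation_mem_span {R K L : Type*} [CommRing R] [IsDomain R] [Field K]
    [Field L] [Algebra R K] [IsFractionRing R K] [Algebra K L] [Algebra R L] [IsScalarTower R K L]
    (x : R) (hx0 : algebraMap R L x ≠ 0) [IsHausdorff (Ideal.span {x}) R] {m : ℕ} (v : Fin m → L)
    (hstep : ∀ a : Fin m → R, (∑ i, a i • v i) = 0 → ∀ i, a i ∈ Ideal.span {x}) :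
    LinearIndependent K v := by
  have hall : ∀ (N : ℕ) (a : Fin m → R), (∑ i, a i • v i) = 0 →
      ∀ i, a i ∈ Ideal.span {x} ^ N := by
    intro N
    induction N with
    | zero => intro a _ i; simp
    | succ N ih =>
      intro a ha i
      have hdiv : ∀ j, ∃ c : R, c * x = a j := fun j =>
        Ideal.mem_span_singleton'.mp (hstep a ha j)
      choose c hc using hdiv
      have hc' : (∑ j, c j • v j) = 0 := by
        have h3 : algebraMap R L x * (∑ j, c j • v j) = 0 := by
          rw [Finset.mul_sum, ← ha]
          refine Finset.sum_congr rfl fun j _ => ?_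
          rw [← hc j, Algebra.smul_def, Algebra.smul_def, map_mul]; ring
        exact (mul_eq_zero.mp h3).resolve_left hx0
      rw [← hc i, pow_succ]
      exact Ideal.mul_mem_mul (ih c hc' i) (Ideal.mem_span_singleton_self x)
  have hzero : ∀ a : Fin m → R, (∑ i, a i • v i) = 0 → ∀ i, a i = 0 := by
    intro a ha i
    refine IsHausdorff.haus (inferInstance : IsHausdorff (Ideal.span {x}) R) (a i) fun N => ?_
    rw [SModEq.zero, smul_eq_mul, Ideal.mul_top]
    exact hall N a ha i
  have hinjRK : Function.Injective (algebraMap R K) := IsFractionRing.injective R K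
  rw [Fintype.linearIndependent_iff]
  intro g hg i
  obtain ⟨b, hb⟩ := IsLocalization.exist_integer_multiples_of_finite (nonZeroDivisors R) g
  choose a ha using hb
  have hrel : (∑ j, a j • v j) = 0 := by
    have : (∑ j, a j • v j) = algebraMap R L (b : R) * ∑ j, g j • v j := by
      rw [Finset.mul_sum]
      refine Finset.sum_congr rfl fun j _ => ?_
      rw [Algebra.smul_def, Algebra.smul_def, IsScalarTower.algebraMap_apply R K L (a j), ha j,
        Algebra.smul_def, map_mul, ← IsScalarTower.algebraMap_apply R K L, mul_assoc]
    rw [this, hg, mul_zero]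
  have hai : a i = 0 := hzero a hrel i
  have hb0 : algebraMap R K (b : R) ≠ 0 :=
    IsFractionRing.to_map_ne_zero_of_mem_nonZeroDivisors b.2
  have : (b : R) • g i = 0 := by rw [← ha i, hai, map_zero]
  rw [Algebra.smul_def] at this
  exact (mul_eq_zero.mp this).resolve_left hb0

/-! ## Tate's theorem, purely inseparable core -/

section Tate

variable {R : Type u} [CommRing R] [IsDomain R] [IsNoetherianRing R] [IsIntegrallyClosed R]
variable {K L : Type u} [Field K] [Field L] [Algebra R K] [IsFractionRing R K] [Algebra K L]
  [Algebra R L] [IsScalarTower R K L]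

omit [IsDomain R] [IsNoetherianRing R] in
/-- In the situation `L^q ⊆ K`, the `q`-th power of an element of `L` integral over the normal
domain `R` lies in `R` ("an element in the intersection has `q`th power contained in …").
[cite: StacksProject, Tag 0BI1 (proof of Lemma 10.161.16)] -/
theorem exists_algebraMap_eq_pow_of_isIntegral_of_pow_mem_range {q : ℕ}
    (hLq : ∀ z : L, ∃ k : K, algebraMap K L k = z ^ q) {f : L} (hf : IsIntegral R f) :
    ∃ r : R, algebraMap R L r = f ^ q := by
  obtain ⟨k, hk⟩ := hLq f
  have hk' : IsIntegral R k := by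
    have : IsIntegral R (algebraMap K L k) := hk ▸ hf.pow q
    exact (isIntegral_algHom_iff (IsScalarTower.toAlgHom R K L) (algebraMap K L).injective).mp this
  obtain ⟨r, hr⟩ := IsIntegrallyClosed.isIntegral_iff.mp hk'
  exact ⟨r, by rw [IsScalarTower.algebraMap_apply R K L, hr, hk]⟩

/-- **Tate's theorem (Stacks 10.161.16 = EGA 0_IV 23.1.3), purely inseparable core.** Let `R` be a
normal Noetherian domain, `x ∈ R` non-zero with `xR` prime, `R` complete and separated for the
`x`-adic topology, and such that the integral closure of `R/xR` in every finite extension of its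
field of fractions is module-finite (`R/xR` is N-2). Let `L ⊇ K = Frac R` be a finite extension with
`L^q ⊆ K` for some `q ≥ 1`, containing `y` with `y^q = x`. Then the integral closure of `R` in `L` is
a finite `R`-module. [cite: StacksProject, Tag 0BI1 (Lemma 10.161.16)]
[cite: EGA0IV, (23.1.3)] -/
theorem module_finite_integralClosure_of_pow_mem (x : R) (hx0 : x ≠ 0)
    (hxp : (Ideal.span {x}).IsPrime) [IsAdicComplete (Ideal.span {x}) R]
    (hN2 : ∀ (k₀ E : Type u) [Field k₀] [Field E] [Algebra (R ⧸ Ideal.span {x}) k₀]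
      [IsFractionRing (R ⧸ Ideal.span {x}) k₀] [Algebra k₀ E] [Algebra (R ⧸ Ideal.span {x}) E]
      [IsScalarTower (R ⧸ Ideal.span {x}) k₀ E] [FiniteDimensional k₀ E],
      Module.Finite (R ⧸ Ideal.span {x}) (integralClosure (R ⧸ Ideal.span {x}) E))
    [FiniteDimensional K L] {q : ℕ} (hq : 0 < q)
    (hLq : ∀ z : L, ∃ k : K, algebraMap K L k = z ^ q) (y : L) (hy : y ^ q = algebraMap R L x) :
    Module.Finite R (integralClosure R L) := by
  classical
  haveI : (Ideal.span {x}).IsPrime := hxp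
  have hinjRL : Function.Injective (algebraMap R L) := by
    rw [IsScalarTower.algebraMap_eq R K L]
    exact (algebraMap K L).injective.comp (IsFractionRing.injective R K)
  have hxL : algebraMap R L x ≠ 0 := fun h => hx0 (hinjRL (by rw [h, map_zero]))
  -- every `f ∈ S` has `f^q ∈ R`: the function `ρ`
  have hpow : ∀ f : integralClosure R L, ∃ r : R, algebraMap R L r = (f : L) ^ q := fun f =>
    exists_algebraMap_eq_pow_of_isIntegral_of_pow_mem_range hLq f.2
  choose ρ hρ using hpow
  have hρ_mul : ∀ f g : integralClosure R L, ρ (f * g) = ρ f * ρ g := fun f g =>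
    hinjRL (by rw [map_mul, hρ, hρ, hρ, Subalgebra.coe_mul, mul_pow])
  have hρ_alg : ∀ r : R, ρ (algebraMap R (integralClosure R L) r) = r ^ q := fun r =>
    hinjRL (by rw [hρ, map_pow]; rfl)
  -- `y ∈ S`
  have hyint : IsIntegral R y := IsIntegral.of_pow hq (hy ▸ isIntegral_algebraMap)
  let yS : integralClosure R L := ⟨y, hyint⟩
  have hy0 : y ≠ 0 := fun h => hxL (by rw [← hy, h, zero_pow hq.ne'])
  have hρy : ρ yS = x := hinjRL (by rw [hρ]; exact hy)
  -- `𝔮 = yS = {f | f^q ∈ xR}` is a prime of `S` lying over `xR`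
  let P : Ideal (integralClosure R L) := Ideal.span {yS}
  have hmemP : ∀ f : integralClosure R L, f ∈ P ↔ ρ f ∈ Ideal.span {x} := by
    intro f
    constructor
    · intro hf
      obtain ⟨g, rfl⟩ := Ideal.mem_span_singleton'.mp hf
      rw [hρ_mul, hρy]
      exact Ideal.mem_span_singleton'.mpr ⟨ρ g, rfl⟩
    · intro hf
      obtain ⟨c, hc⟩ := Ideal.mem_span_singleton'.mp hf
      have hfy : ((f : L) / y) ^ q = algebraMap R L c := by
        have h1 : (f : L) ^ q = algebraMap R L c * y ^ q := by
          rw [← hρ, ← hc, map_mul, hy]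
        rw [div_pow, h1, mul_div_assoc, div_self (pow_ne_zero _ hy0), mul_one]
      have hint : IsIntegral R ((f : L) / y) := IsIntegral.of_pow hq (hfy ▸ isIntegral_algebraMap)
      refine Ideal.mem_span_singleton'.mpr ⟨⟨(f : L) / y, hint⟩, ?_⟩
      apply Subtype.ext
      change (f : L) / y * y = f
      exact div_mul_cancel₀ _ hy0
  haveI hPprime : P.IsPrime := by
    refine Ideal.isPrime_iff.mpr ⟨?_, fun {f g} hfg => ?_⟩
    · intro htop
      have h1 : (1 : integralClosure R L) ∈ P := htop ▸ Submodule.mem_top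
      rw [hmemP, show ρ 1 = 1 from by simpa using hρ_alg 1] at h1
      exact hxp.ne_top ((Ideal.eq_top_iff_one _).mpr h1)
    · rw [hmemP, hρ_mul] at hfg
      rcases hxp.mem_or_mem hfg with h | h
      · exact Or.inl ((hmemP f).mpr h)
      · exact Or.inr ((hmemP g).mpr h)
  have hcomap : ∀ r : R, algebraMap R (integralClosure R L) r ∈ P ↔ r ∈ Ideal.span {x} := fun r => by
    rw [hmemP, hρ_alg]
    exact ⟨fun h => hxp.mem_of_pow_mem q h, fun h => Ideal.pow_mem_of_mem _ h q hq⟩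
  -- the residue rings `R₀ = R/xR ⊆ S₀ = S/yS`
  have hIle : Ideal.span {x} ≤ P.comap (algebraMap R (integralClosure R L)) :=
    fun r hr => (hcomap r).mpr hr
  letI : Algebra (R ⧸ Ideal.span {x}) (integralClosure R L ⧸ P) :=
    (Ideal.quotientMap P (algebraMap R (integralClosure R L)) hIle).toAlgebra
  haveI : IsScalarTower R (R ⧸ Ideal.span {x}) (integralClosure R L ⧸ P) :=
    IsScalarTower.of_algebraMap_eq fun r => rfl
  have hφinj : Function.Injective (algebraMap (R ⧸ Ideal.span {x}) (integralClosure R L ⧸ P)) := by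
    refine (injective_iff_map_eq_zero _).mpr fun a ha => ?_
    obtain ⟨r, rfl⟩ := Ideal.Quotient.mk_surjective a
    change Ideal.quotientMap P _ hIle (Ideal.Quotient.mk _ r) = 0 at ha
    rw [Ideal.quotientMap_mk, Ideal.Quotient.eq_zero_iff_mem] at ha
    exact Ideal.Quotient.eq_zero_iff_mem.mpr ((hcomap r).mp ha)
  haveI : Algebra.IsIntegral (R ⧸ Ideal.span {x}) (integralClosure R L ⧸ P) := by
    refine ⟨fun z => ?_⟩
    obtain ⟨s, rfl⟩ := Ideal.Quotient.mk_surjective z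
    have h0 : IsIntegral R s := Algebra.IsIntegral.isIntegral s
    exact (h0.map (IsScalarTower.toAlgHom R (integralClosure R L) (integralClosure R L ⧸ P))).tower_top
  -- linearly independent residues lift to `K`-linearly independent elements of `L`
  have hlift : ∀ (m : ℕ) (w : Fin m → integralClosure R L ⧸ P),
      LinearIndependent (R ⧸ Ideal.span {x}) w → m ≤ Module.finrank K L := by
    intro m w hw
    choose s hs using fun i => Ideal.Quotient.mk_surjective (w i)
    have hstep : ∀ a : Fin m → R, (∑ i, a i • (s i : L)) = 0 → ∀ i, a i ∈ Ideal.span {x} := by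
      intro a ha i
      have hsum : (∑ i, a i • s i : integralClosure R L) = 0 := by
        have h1 : (integralClosure R L).val (∑ i, a i • s i) = 0 := by
          rw [map_sum]; simpa using ha
        exact Subtype.ext h1
      have hrel : ∑ i, Ideal.Quotient.mk (Ideal.span {x}) (a i) • w i = 0 := by
        have h2 : Ideal.Quotient.mk P (∑ i, a i • s i) = 0 := by rw [hsum, map_zero]
        rw [map_sum] at h2
        rw [← h2]
        refine Finset.sum_congr rfl fun i _ => ?_
        rw [← hs i, Algebra.smul_def, Algebra.smul_def, map_mul]
        rfl
      exact Ideal.Quotient.eq_zero_iff_mem.mp ((Fintype.linearIndependent_iff.mp hw) _ hrel i)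
    have hliK : LinearIndependent K (fun i => (s i : L)) :=
      linearIndependent_of_forall_relation_mem_span x hxL _ hstep
    simpa using hliK.fintype_card_le_finrank
  -- `S/yS` is finite over `R/xR`, hence over `R`
  haveI : Module.Finite (R ⧸ Ideal.span {x}) (integralClosure R L ⧸ P) :=
    module_finite_of_isIntegral_of_linearIndependent_le hφinj hN2 _ hlift
  haveI : Module.Finite R (integralClosure R L ⧸ P) :=
    Module.Finite.trans (R ⧸ Ideal.span {x}) _
  -- hence every `S/yⁿS` is Noetherian over `R`, in particular `S/xS`
  have hN1 : IsNoetherian R (integralClosure R L ⧸ P.restrictScalars R) :=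
    isNoetherian_of_linearEquiv (Submodule.Quotient.restrictScalarsEquiv R P).symm
  have hNq : IsNoetherian R (integralClosure R L ⧸ (Ideal.span {yS ^ q}).restrictScalars R) :=
    isNoetherian_quotient_span_singleton_pow yS hN1 q
  have hxS : ((Ideal.span {x}) • ⊤ : Submodule R (integralClosure R L)) =
      (Ideal.span {yS ^ q}).restrictScalars R := by
    have hyq : yS ^ q = algebraMap R (integralClosure R L) x := Subtype.ext (by simpa using hy)
    ext z
    rw [Submodule.ideal_span_singleton_smul, Submodule.mem_smul_pointwise_iff_exists,
      Submodule.restrictScalars_mem, hyq, Ideal.mem_span_singleton']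
    constructor
    · rintro ⟨t, -, rfl⟩; exact ⟨t, by rw [Algebra.smul_def, mul_comm]⟩
    · rintro ⟨t, rfl⟩; exact ⟨t, Submodule.mem_top, by rw [Algebra.smul_def, mul_comm]⟩
  haveI hfinq : Module.Finite R
      (integralClosure R L ⧸ ((Ideal.span {x}) • ⊤ : Submodule R (integralClosure R L))) := by
    rw [hxS]; exact Module.IsNoetherian.finite R _
  -- `S` is `x`-adically separated
  haveI : IsHausdorff (Ideal.span {x}) (integralClosure R L) := by
    refine ⟨fun z hz => ?_⟩
    have hzn : ∀ n : ℕ, ρ z ∈ Ideal.span {x} ^ n := by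
      intro n
      have hz' := hz n
      rw [SModEq.zero, Ideal.span_singleton_pow, Submodule.ideal_span_singleton_smul,
        Submodule.mem_smul_pointwise_iff_exists] at hz'
      obtain ⟨t, -, ht⟩ := hz'
      have : ρ z = x ^ n * ((x ^ n) ^ (q - 1) * ρ t) := by
        apply hinjRL
        rw [hρ, map_mul, map_mul, map_pow (algebraMap R L) (x ^ n) (q - 1), hρ, ← ht,
          Subalgebra.coe_smul, Algebra.smul_def, mul_pow, ← mul_assoc, ← pow_succ',
          Nat.sub_add_cancel hq]
      rw [this, Ideal.span_singleton_pow]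
      exact Ideal.mul_mem_right _ _ (Ideal.mem_span_singleton_self _)
    have hρz : ρ z = 0 :=
      IsHausdorff.haus (inferInstance : IsHausdorff (Ideal.span {x}) R) (ρ z) fun n => by
        rw [SModEq.zero, smul_eq_mul, Ideal.mul_top]; exact hzn n
    have : (z : L) ^ q = 0 := by rw [← hρ, hρz, map_zero]
    exact Subtype.ext (pow_eq_zero_iff hq.ne' |>.mp this)
  -- conclusion: Matsumura 8.4 / Stacks 10.96.12
  obtain ⟨k, v, hv⟩ := Module.Finite.exists_fin (R := R)
    (M := integralClosure R L ⧸ ((Ideal.span {x}) • ⊤ : Submodule R (integralClosure R L)))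
  choose u hu using fun i =>
    Submodule.Quotient.mk_surjective ((Ideal.span {x}) • ⊤ : Submodule R (integralClosure R L)) (v i)
  refine Literature.Algebra.Module.finite_of_isHausdorff_of_forall_mem_sup (Ideal.span {x}) u
    fun m => ?_
  have hN : Submodule.span R (Set.range u) ⊔
      ((Ideal.span {x}) • ⊤ : Submodule R (integralClosure R L)) = ⊤ := by
    have hmap : (Submodule.span R (Set.range u)).map
        ((Ideal.span {x}) • ⊤ : Submodule R (integralClosure R L)).mkQ = ⊤ := by
      rw [Submodule.map_span, ← hv]
      congr 1
      ext z
      simp only [Set.mem_image, Set.mem_range, exists_exists_eq_and, Submodule.mkQ_apply, hu]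
    have := congrArg (Submodule.comap
      ((Ideal.span {x}) • ⊤ : Submodule R (integralClosure R L)).mkQ) hmap
    rwa [Submodule.comap_map_mkQ, Submodule.comap_top, sup_comm] at this
  rw [hN]; exact Submodule.mem_top

end Tate

end Literature.AlgebraicGeometry.Resolution

end
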